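import Summits.ResolutionOfSingularities.ResolutionOfSingularities.Theorems.CofactorCutCells
import Summits.ResolutionOfSingularities.ResolutionOfSingularities.Theorems.TauChainLaw2
import Literature.AlgebraicGeometry.Resolution.NearPointsPointCentreLineCurve
import HarnessLib

/-! # DirectrixCutKernels — decomp-res-lens-4 g41 node «DirectrixCut», FILE A (§139 the directrix LETTERS (PCF)
`PlaneConeFreeCompanionTower` / (KPCF) `PlaneConeFreeCofactorTower`, stated BEFORE the law; §140 LAW A «a birth forces `τ = 1`, hence a
RATIONAL PLANE CONE» — Literature CossartPiltant2008 Lemma 4.3 `IsBlowup.stalkTau_eq_one_of_isNear_of_not_isClosed` + g31 KERNEL B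
`planeConeAt_of_stalkTau_eq_one` BY NAME, with the tower bridge (born ⇒ non-closed near point of exact order over the point centre);
COROLLARIES A′ (born set through `x_{i+1}` a subsingleton — equal-or-disjoint closures ONLY, no `L_x ≅ ℙ¹` uniqueness claimed —
count `μ_{i+1} ≤ μ_i + 1`), A″ (the born branch is a regular exceptional line), the THREAD form of g38's curve chain and the HOP law;
§141 the declared dependences (PCF) ⟹ (FB), (KPCF) ⟹ (KFB) = the kill content, and the MECHANISM STATEMENT of the new core as theorems).
Cone-free (no Theses import); hypothesis-free, port-free, weight-free, no `MinimalAt`.  VERBATIM slice of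
HOME/decomp-res-lens-4/g41/DirectrixCut.lean (node thesis, honest placement UNDECIDED · IDEA-NEEDED and sources in its module docstring).
(Sources: CossartPiltant2008 Lemma 4.3 (1)(3)(5), Prop. 4.4; CossartJannsenSaito2020 Def. 6.38, Thm. 6.40; Hironaka1964 Ch. III §3;
Giraud1975.) -/


noncomputable section

open CategoryTheory AlgebraicGeometry IsLocalRing TopologicalSpace
open Literature.AlgebraicGeometry.Resolution
open Summit.ResolutionOfSingularities.ResolutionOfSingularities.Theorems
open WeakOrderReduction ForcedTowerClasses DivergentTowerClasses MonomialTowerClasses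
open HugDimensionClasses HugDimensionKernels SurfaceShadowClasses SurfaceShadowKernels
open NearPointCut (SingularClass)
open Scheme.IdealSheafData (vanishingIdeal)

universe u

namespace Summit.ResolutionOfSingularities.ResolutionOfSingularities.Theorems.HugValuationCut

/-! ## ══ FILE A `Theorems/DirectrixCutKernels.lean` (§139–§141; cone-free; imports the LANDED `CofactorCutCells`, `TauChainLaw2` and
Literature `NearPointsPointCentreLineCurve`) ══ -/

section DirectrixKernels

variable {k : Type} [Field k]

/-! ## §139 (g41 · NEW · LETTERS) THE DIRECTRIX LETTERS (PCF) / (KPCF) — stated BEFORE the law, so that the independence batteries of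
`bc/Probe.lean` run without LAW A in scope -/

/-- **LETTER (PCF) «PLANE-CONE-FREE COMPANION»** (NEW, tower-intrinsic, by mechanism): at some stage some PRINCIPAL factor `h` of weight
`a ≥ 2` of the marked stalk (`𝓘_{x_m} = (h)·K_{x_m}`) is NEVER a rational plane cone along its chain of weight-`a` controlled transforms:
at every later marked point the degree-`a` initial form of `h_j` is NOT `c̄·Z^a` for a rational linear form — `τ(h_j) = 2`, the directrix
is a LINE, `e ≤ 1` (CossartJannsenSaito2020 Def. 6.38, the `e_x ≤ 1` regime). -/
def PlaneConeFreeCompanionTower (T : ForcedTower) : Prop :=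
  ∃ (m a b : ℕ) (H K : (T.St m).IdealSheafData), FactorAt T m a b H K ∧ 2 ≤ a ∧ (stalkIdeal H (T.pt m)).IsPrincipal ∧
    ∀ j, ¬ PlaneConeAt (facIter T m a H j) a (T.pt (m + j))

/-- **LETTER (KPCF) «PLANE-CONE-FREE COFACTOR»** (NEW, by mechanism): at some stage some principal factor of weight `a ≥ 2` has a
COFACTOR `K` of positive weight `b` that is never a rational plane cone along its chain of weight-`b` controlled transforms. -/
def PlaneConeFreeCofactorTower (T : ForcedTower) : Prop :=
  ∃ (m a b : ℕ) (H K : (T.St m).IdealSheafData), FactorAt T m a b H K ∧ 2 ≤ a ∧ (stalkIdeal H (T.pt m)).IsPrincipal ∧ 1 ≤ b ∧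
    ∀ j, ¬ PlaneConeAt (facIter T m b K j) b (T.pt (m + j))

/-- pure logic: the NEGATION of (PCF) — «CONE-RECURRENT COMPANIONS»: every principal factor of weight `≥ 2` at every stage is a rational
plane cone at some step of its chain. [folklore] -/
theorem not_planeConeFreeCompanionTower_iff (T : ForcedTower) :
    ¬ PlaneConeFreeCompanionTower T ↔
      ∀ (m a b : ℕ) (H K : (T.St m).IdealSheafData), FactorAt T m a b H K → 2 ≤ a → (stalkIdeal H (T.pt m)).IsPrincipal →
        ∃ j, PlaneConeAt (facIter T m a H j) a (T.pt (m + j)) := by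
  simp only [PlaneConeFreeCompanionTower, not_exists, not_and, not_forall, not_not]

/-- pure logic: the NEGATION of (KPCF) — «CONE-RECURRENT COFACTORS». [folklore] -/
theorem not_planeConeFreeCofactorTower_iff (T : ForcedTower) :
    ¬ PlaneConeFreeCofactorTower T ↔
      ∀ (m a b : ℕ) (H K : (T.St m).IdealSheafData), FactorAt T m a b H K → 2 ≤ a → (stalkIdeal H (T.pt m)).IsPrincipal →
        1 ≤ b → ∃ j, PlaneConeAt (facIter T m b K j) b (T.pt (m + j)) := by
  simp only [PlaneConeFreeCofactorTower, not_exists, not_and, not_forall, not_not]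

/-! ## §140 (g41 · NEW · KERNEL) LAW A — A BIRTH FORCES `τ = 1`, A RATIONAL PLANE CONE, A UNIQUE BORN BRANCH, A REGULAR EXCEPTIONAL LINE;
THE THREAD FORM OF g38's CURVE CHAIN (for the HOP law) -/

/-- a point with a proper specialisation is not a closed point. [folklore] -/
theorem not_isClosed_singleton_of_specializes_ne {X : Scheme.{0}} {η x : X} (h : η ⤳ x) (hne : η ≠ x) :
    ¬ IsClosed ({η} : Set X) := fun hcl =>
  hne (Set.mem_singleton_iff.mp (h.mem_closed hcl (Set.mem_singleton η))).symm

/-- **a born near-branch is a NEAR POINT of the blown-up marked point** (order of the weight-`a` transform EXACTLY `a`: `≥ a` as a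
near-branch, `≤ a` over the point centre by the tree's CossartPiltant2008 Prop. 4.2 (a) `IsBlowup.idealOrder_controlledTransform_le_of_mem`).
(Sources: CossartPiltant2008, Prop. 4.2 (a).) -/
theorem isNear_of_mem_bornSet (T : ForcedTower) (g : T.St 0 ⟶ Spec (.of k)) (hB : IsBase (T.St 0) g) {i a : ℕ}
    {G : (T.St i).IdealSheafData} (hG : idealOrder G (T.pt i) = ((a : ℕ) : ℕ∞)) {η : T.St (i + 1)}
    (hη : η ∈ bornSet T i a (controlledTransform (T.π i) (T.centre i) G a)) :
    IsNear (T.π i) (vanishingIdeal ⟨{T.pt i}, T.isClosed_pt i⟩) G a η := by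
  obtain ⟨hNi, hRi⟩ := tower_isLocallyNoetherian_isRegular T g hB i
  obtain ⟨hNi1, -⟩ := tower_isLocallyNoetherian_isRegular T g hB (i + 1)
  haveI := hNi
  haveI := hNi1
  obtain ⟨⟨-, -, hle⟩, hbase⟩ := hη
  rw [tower_centre_eq_vanishingIdeal T i] at hle
  have hY : ∀ y ∈ ((⟨{T.pt i}, T.isClosed_pt i⟩ : Closeds (T.St i)) : Set (T.St i)), idealOrder G y = ((a : ℕ) : ℕ∞) := by
    rintro y (rfl : y = T.pt i)
    exact hG
  have hup := (tower_isBlowup_vanishingIdeal T i).idealOrder_controlledTransform_le_of_mem hRi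
    (isRegular_subscheme_vanishingIdeal_singleton (T.isClosed_pt i)) hY (x' := η) hbase
  exact le_antisymm hup hle

/-- **LAW A (τ-form) — A BIRTH FORCES `τ(G, x_i, a) = 1`.**  For an ideal sheaf `G` of order exactly `a ≥ 1` at the marked point `x_i`
of a threefold forced tower, a near-branch of its weight-`a` controlled transform through `x_{i+1}` over `x_i` (an element of g38's
`bornSet`) is a NON-CLOSED NEAR POINT over the closed point `x_i`, so Hironaka's `τ = 1` at `x_i` (Literature CossartPiltant2008 Lemma 4.3
(1) and (3) BY NAME: `τ = 3` admits no near point, `τ = 2` only a closed one).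
(Sources: CossartPiltant2008, Lemma 4.3 (1) (3); Hironaka1964, Ch. III §3.) -/
theorem stalkTau_eq_one_of_mem_bornSet (T : ForcedTower) (g : T.St 0 ⟶ Spec (.of k)) (hB : IsBase (T.St 0) g)
    (h3 : ThreefoldTower T) {i a : ℕ} (ha : 1 ≤ a) {G : (T.St i).IdealSheafData}
    (hG : idealOrder G (T.pt i) = ((a : ℕ) : ℕ∞)) {η : T.St (i + 1)}
    (hη : η ∈ bornSet T i a (controlledTransform (T.π i) (T.centre i) G a)) :
    (haveI := tower_isRegular T g hB i (T.pt i); stalkTau G (T.pt i) a) = 1 := by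
  obtain ⟨hNi, hRi⟩ := tower_isLocallyNoetherian_isRegular T g hB i
  obtain ⟨hNi1, -⟩ := tower_isLocallyNoetherian_isRegular T g hB (i + 1)
  haveI := hNi
  haveI := hNi1
  exact (tower_isBlowup_vanishingIdeal T i).stalkTau_eq_one_of_isNear_of_not_isClosed hRi (T.isClosed_pt i) ha hG
    (tower_spanFinrank_eq_three T g hB h3 i) hη.2 (isNear_of_mem_bornSet T g hB hG hη)
    (not_isClosed_singleton_of_specializes_ne hη.1.1 hη.1.2.1)

/-- **LAW A — A BIRTH FORCES A RATIONAL PLANE CONE** (`τ = 1` ⟹ `PlaneConeAt`, g31/§94 KERNEL B `planeConeAt_of_stalkTau_eq_one` BY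
NAME): the degree-`a` initial form of `G` at `x_i` is `c̄·Z^a` for a `κ(x_i)`-rational linear form `Z` — the directrix is the PLANE
`Z = 0` (`e = ē = 2`) and the born branch is a non-closed point of the LINE `ℙ(Dir) ⊂ E_i`.
(Sources: CossartPiltant2008, Lemma 4.3 (1) (3) (5); CossartJannsenSaito2020, Def. 6.38 (i).) -/
theorem planeConeAt_of_mem_bornSet (T : ForcedTower) (g : T.St 0 ⟶ Spec (.of k)) (hB : IsBase (T.St 0) g)
    (h3 : ThreefoldTower T) {i a : ℕ} (ha : 1 ≤ a) {G : (T.St i).IdealSheafData}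
    (hG : idealOrder G (T.pt i) = ((a : ℕ) : ℕ∞)) {η : T.St (i + 1)}
    (hη : η ∈ bornSet T i a (controlledTransform (T.π i) (T.centre i) G a)) : PlaneConeAt G a (T.pt i) := by
  haveI := tower_isRegular T g hB i (T.pt i)
  exact planeConeAt_of_stalkTau_eq_one G ha (T.pt i) (tower_spanFinrank_eq_three T g hB h3 i) hG
    (stalkTau_eq_one_of_mem_bornSet T g hB h3 ha hG hη)

/-- **LAW A on g38's birth predicate `BornAbs`.** [folklore] -/
theorem planeConeAt_of_bornAbs (T : ForcedTower) (g : T.St 0 ⟶ Spec (.of k)) (hB : IsBase (T.St 0) g)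
    (h3 : ThreefoldTower T) {i a : ℕ} (ha : 1 ≤ a) {G : (T.St i).IdealSheafData}
    (hG : idealOrder G (T.pt i) = ((a : ℕ) : ℕ∞)) (hborn : BornAbs T i a (controlledTransform (T.π i) (T.centre i) G a)) :
    PlaneConeAt G a (T.pt i) := by
  obtain ⟨η, hη, hb⟩ := hborn
  exact planeConeAt_of_mem_bornSet T g hB h3 ha hG ⟨hη, hb⟩

/-- **LAW A ALONG A FACTOR CHAIN**: a birth at step `j` of the weight-`a` chain of a factor `H` of a factorization `𝓘_{x_m} = H·K`
(g33 `FactorAt`, orders exactly `a`, `b` at every later marked point by g33 `FactorAt.forcing`) makes `h_j = facIter T m a H j` a rational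
PLANE CONE at `x_{m+j}`.  (For the cofactor chain apply it to `FactorAt.symm`.) [folklore] -/
theorem planeConeAt_facIter_of_bornAt (T : ForcedTower) (g : T.St 0 ⟶ Spec (.of k)) (hB : IsBase (T.St 0) g) {n : ℕ}
    (hD : IsDatum n (T.D 0)) (h3 : ThreefoldTower T) {m a b : ℕ} {H K : (T.St m).IdealSheafData} (hF : FactorAt T m a b H K)
    (ha : 1 ≤ a) {j : ℕ} (hborn : BornAt T m a H j) : PlaneConeAt (facIter T m a H j) a (T.pt (m + j)) :=
  planeConeAt_of_bornAbs T g hB h3 ha (hF.forcing T g hB hD j).2.1 hborn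

/-- **LAW A′ — BIRTHS ARE SIMPLE: the born set is a subsingleton** (two non-closed near points over a `τ = 1` point are equal or have
disjoint closures, Literature CossartPiltant2008 Lemma 4.3 (5) `IsBlowup.eq_or_disjoint_closure_of_isNear_of_not_isClosed` BY NAME;
both born branches specialise to `x_{i+1}`, so their closures meet).  RIDER: «uniqueness» here = the equal-or-disjoint-closures
dichotomy ONLY; the Literature file does NOT prove the full `L_x ≅ ℙ¹` uniqueness of the near line and none is claimed — the
subsingleton is the born set THROUGH `x_{i+1}`, not the set of all near points.  (Sources: CossartPiltant2008, Lemma 4.3 (5).) -/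
theorem bornSet_subsingleton (T : ForcedTower) (g : T.St 0 ⟶ Spec (.of k)) (hB : IsBase (T.St 0) g)
    (h3 : ThreefoldTower T) {i a : ℕ} (ha : 1 ≤ a) {G : (T.St i).IdealSheafData}
    (hG : idealOrder G (T.pt i) = ((a : ℕ) : ℕ∞)) :
    (bornSet T i a (controlledTransform (T.π i) (T.centre i) G a)).Subsingleton := by
  intro η hη η' hη'
  obtain ⟨hNi, hRi⟩ := tower_isLocallyNoetherian_isRegular T g hB i
  obtain ⟨hNi1, -⟩ := tower_isLocallyNoetherian_isRegular T g hB (i + 1)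
  haveI := hNi
  haveI := hNi1
  have hτ := stalkTau_eq_one_of_mem_bornSet T g hB h3 ha hG hη
  rcases (tower_isBlowup_vanishingIdeal T i).eq_or_disjoint_closure_of_isNear_of_not_isClosed hRi (T.isClosed_pt i) hG
      (tower_spanFinrank_eq_three T g hB h3 i) hτ hη.2 (isNear_of_mem_bornSet T g hB hG hη)
      (not_isClosed_singleton_of_specializes_ne hη.1.1 hη.1.2.1) hη'.2 (isNear_of_mem_bornSet T g hB hG hη')
      (not_isClosed_singleton_of_specializes_ne hη'.1.1 hη'.1.2.1) with h | h
  · exact h.symm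
  · exact absurd (Set.disjoint_iff.mp h ⟨specializes_iff_mem_closure.mp hη.1.1, specializes_iff_mem_closure.mp hη'.1.1⟩)
      (Set.notMem_empty _)

/-- **LAW A′, counted: AT MOST ONE BIRTH PER STEP.** [folklore] -/
theorem ncard_bornSet_le_one (T : ForcedTower) (g : T.St 0 ⟶ Spec (.of k)) (hB : IsBase (T.St 0) g)
    (h3 : ThreefoldTower T) {i a : ℕ} (ha : 1 ≤ a) {G : (T.St i).IdealSheafData}
    (hG : idealOrder G (T.pt i) = ((a : ℕ) : ℕ∞)) :
    (bornSet T i a (controlledTransform (T.π i) (T.centre i) G a)).ncard ≤ 1 :=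
  (Set.ncard_le_one (bornSet_subsingleton T g hB h3 ha hG).finite).mpr fun _ hx _ hy =>
    bornSet_subsingleton T g hB h3 ha hG hx hy

/-- **THE SHARPENED COUNT LAW `μ_{i+1} ≤ μ_i + 1`** (g38 (β2) `ncard_brSet_succ_le_add` + LAW A′). [folklore] -/
theorem ncard_brSet_succ_le_succ (T : ForcedTower) (g : T.St 0 ⟶ Spec (.of k)) (hB : IsBase (T.St 0) g)
    (h3 : ThreefoldTower T) {i a : ℕ} (ha : 1 ≤ a) {G : (T.St i).IdealSheafData}
    (hG : idealOrder G (T.pt i) = ((a : ℕ) : ℕ∞)) (hfin : (brSet T i a G).Finite) :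
    (brSet T (i + 1) a (controlledTransform (T.π i) (T.centre i) G a)).ncard ≤ (brSet T i a G).ncard + 1 := by
  haveI : ∀ j, IsLocallyNoetherian (T.St j) := fun j => (tower_isLocallyNoetherian_isRegular T g hB j).1
  exact (ncard_brSet_succ_le_add T i a G hfin).trans (Nat.add_le_add_left (ncard_bornSet_le_one T g hB h3 ha hG) _)

/-- **THE SHARPENED COUNT LAW, junk-free in `ℕ∞`: `μ_{i+1} ≤ μ_i + 1`** (g38 `encard_brSet_succ_le_add` + LAW A′). [folklore] -/
theorem encard_brSet_succ_le_succ (T : ForcedTower) (g : T.St 0 ⟶ Spec (.of k)) (hB : IsBase (T.St 0) g)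
    (h3 : ThreefoldTower T) {i a : ℕ} (ha : 1 ≤ a) {G : (T.St i).IdealSheafData}
    (hG : idealOrder G (T.pt i) = ((a : ℕ) : ℕ∞)) :
    (brSet T (i + 1) a (controlledTransform (T.π i) (T.centre i) G a)).encard ≤ (brSet T i a G).encard + 1 := by
  haveI : ∀ j, IsLocallyNoetherian (T.St j) := fun j => (tower_isLocallyNoetherian_isRegular T g hB j).1
  refine (encard_brSet_succ_le_add T i a G).trans (add_le_add le_rfl ?_)
  exact Set.encard_le_one_iff.mpr fun _ _ hx hy => bornSet_subsingleton T g hB h3 ha hG hx hy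

/-- **LAW A″ — THE BORN BRANCH IS A REGULAR EXCEPTIONAL LINE**: the closure of a born near-branch, with its reduced structure, is a
regular subscheme of `X_{i+1}` (Literature CossartPiltant2008 Lemma 4.3 (5) / Prop. 4.4 (*)
`IsBlowup.isRegular_subscheme_closure_of_isNear_of_not_isClosed` BY NAME: cut out by rsop PAIRS at each of its points).
(Sources: CossartPiltant2008, Lemma 4.3 (5), Prop. 4.4 (*).) -/
theorem isRegular_closure_of_mem_bornSet (T : ForcedTower) (g : T.St 0 ⟶ Spec (.of k)) (hB : IsBase (T.St 0) g)
    (h3 : ThreefoldTower T) {i a : ℕ} (ha : 1 ≤ a) {G : (T.St i).IdealSheafData}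
    (hG : idealOrder G (T.pt i) = ((a : ℕ) : ℕ∞)) {η : T.St (i + 1)}
    (hη : η ∈ bornSet T i a (controlledTransform (T.π i) (T.centre i) G a)) :
    Scheme.IsRegular (vanishingIdeal (⟨closure {η}, isClosed_closure⟩ : Closeds (T.St (i + 1)))).subscheme := by
  obtain ⟨hNi, hRi⟩ := tower_isLocallyNoetherian_isRegular T g hB i
  obtain ⟨hNi1, -⟩ := tower_isLocallyNoetherian_isRegular T g hB (i + 1)
  haveI := hNi
  haveI := hNi1
  exact ((tower_isBlowup_vanishingIdeal T i).isRegular_subscheme_closure_of_isNear_of_not_isClosed hRi (T.isClosed_pt i) hG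
    (tower_spanFinrank_eq_three T g hB h3 i) (stalkTau_eq_one_of_mem_bornSet T g hB h3 ha hG hη) hη.2
    (isNear_of_mem_bornSet T g hB hG hη) (not_isClosed_singleton_of_specializes_ne hη.1.1 hη.1.2.1)).1

/-- transport of `PlaneConeAt` at the marked point along an index equality (re-rooting bookkeeping). [folklore] -/
theorem planeConeAt_pt_iff_of_heq (T : ForcedTower) (a : ℕ) {i i' : ℕ} (e : i = i') {G : (T.St i).IdealSheafData}
    {G' : (T.St i').IdealSheafData} (h : HEq G G') : PlaneConeAt G a (T.pt i) ↔ PlaneConeAt G' a (T.pt i') := by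
  subst e
  rw [heq_iff_eq] at h
  subst h
  exact Iff.rfl


/-- **THE CURVE CHAIN OF A THREAD** (g38 (L4 · CURVE) `followsCurveTower_of_branch_chain`, thread form: the persistence hypothesis
replaced by ONE given thread).  A thread of proper generizations `ζ_i ⤳ x_i`, `ζ_i ≠ x_i`, `π_i ζ_{i+1} = ζ_i` (`i ≥ m₁`) of the marked
points whose initial prime is a curve germ (`dim 𝒪_{x_{m₁}}/𝔭_{ζ_{m₁}} = 1`) makes the tower FOLLOW A CURVE GERM (letter (CF∞) of g37):
the primes `𝔭_{ζ_i} ⊂ 𝒪_{x_i}` are a compatible curve chain (g38 `comap_stalkMapCongr_primeOfSpecializes` BY NAME). [folklore] -/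
theorem followsCurveTower_of_thread (T : ForcedTower) (m₁ : ℕ) (ζ : ∀ i, m₁ ≤ i → T.St i)
    (hsp : ∀ i (h : m₁ ≤ i), ζ i h ⤳ T.pt i) (hne : ∀ i (h : m₁ ≤ i), ζ i h ≠ T.pt i)
    (hπζ : ∀ i (h : m₁ ≤ i), (T.π i).base (ζ (i + 1) (Nat.le_succ_of_le h)) = ζ i h)
    (hdim : ringKrullDim ((T.St m₁).presheaf.stalk (T.pt m₁) ⧸ primeOfSpecializes (hsp m₁ le_rfl)) = 1) :
    FollowsCurveTower T := by
  have hsp' : ∀ i (h : m₁ ≤ i), ζ i h ⤳ (T.π i).base (T.pt (i + 1)) := fun i h => by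
    rw [T.pt_map]
    exact hsp i h
  let 𝔮 : ∀ i, Ideal (lineRing T i 0) := fun i => if h : m₁ ≤ i then primeOfSpecializes (hsp' i h) else ⊥
  have h𝔮 : ∀ i (h : m₁ ≤ i), 𝔮 i = primeOfSpecializes (hsp' i h) := fun i h => dif_pos h
  refine ⟨m₁, 𝔮, fun i hi => ⟨?_, ?_, ?_⟩, ?_⟩
  · rw [h𝔮 i hi]
    infer_instance
  · rw [h𝔮 i hi]
    exact primeOfSpecializes_ne_maximalIdeal_of_ne (hsp' i hi) (by rw [T.pt_map]; exact hne i hi)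
  · rw [h𝔮 i hi, h𝔮 (i + 1) (Nat.le_succ_of_le hi)]
    have e := hπζ i hi
    have hmap : (T.π i).base (ζ (i + 1) (Nat.le_succ_of_le hi)) ⤳ (T.π i).base (T.pt (i + 1)) :=
      (hsp (i + 1) (Nat.le_succ_of_le hi)).map (T.π i).continuous
    rw [← primeOfSpecializes_congr_left e hmap (hsp' i hi)]
    exact comap_stalkMapCongr_primeOfSpecializes (T.π i) (T.pt (i + 1)) ((T.π (i + 1)).base (T.pt (i + 1 + 1)))
      (T.pt_map (i + 1)) (hsp' (i + 1) (Nat.le_succ_of_le hi)) hmap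
  · rw [h𝔮 m₁ le_rfl]
    show ringKrullDim ((T.St m₁).presheaf.stalk ((T.π m₁).base (T.pt (m₁ + 1))) ⧸ primeOfSpecializes (hsp' m₁ le_rfl)) = 1
    rw [ringKrullDim_quotient_primeOfSpecializes_congr_right (T.pt_map m₁) (hsp' m₁ le_rfl) (hsp m₁ le_rfl)]
    exact hdim

/-- **THE HOP LAW (kernel form): IN A TOWER FOLLOWING NO CURVE GERM, NO NEAR-BRANCH OF A FACTOR CHAIN IS THREADED BY THE MARKED POINTS
FOR EVER** (a near-branch of a factor of an occult threefold tower is a curve germ, g39 (L1e′); a thread through it would be a curve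
chain, `followsCurveTower_of_thread`). [folklore] -/
theorem not_threaded_of_not_followsCurveTower (T : ForcedTower) (g : T.St 0 ⟶ Spec (.of k)) (hB : IsBase (T.St 0) g)
    (hocc : ¬ LatentFactorTower T) (h3 : ThreefoldTower T) (hCF : ¬ FollowsCurveTower T) {i a b : ℕ}
    {G K : (T.St i).IdealSheafData} (hF : FactorAt T i a b G K) (ha : 1 ≤ a) (ζ : ∀ i', i ≤ i' → T.St i')
    (hζ : ζ i le_rfl ∈ brSet T i a G) (hsp : ∀ i' (h : i ≤ i'), ζ i' h ⤳ T.pt i') (hne : ∀ i' (h : i ≤ i'), ζ i' h ≠ T.pt i')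
    (hπζ : ∀ i' (h : i ≤ i'), (T.π i').base (ζ (i' + 1) (Nat.le_succ_of_le h)) = ζ i' h) : False :=
  hCF (followsCurveTower_of_thread T i ζ hsp hne hπζ
    (ringKrullDim_quotient_primeOfSpecializes_eq_one_of_mem_brSet' T g hB hocc h3 hF ha hζ))


/-! ## §141 (g41 · NEW) THE DECLARED DEPENDENCES (PCF) ⟹ (FB), (KPCF) ⟹ (KFB) = THE KILL CONTENT, AND THE MECHANISM STATEMENT OF THE
NEW CORE AS THEOREMS: LATE PLANE CONES ON BOTH CHAINS, SIMPLE BIRTHS AT PLANE-CONE STAGES, REGULAR BORN LINES, THE HOP -/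

/-- **DECLARED DEPENDENCE (PCF) ⟹ (FB)** — THE KILL CONTENT (LAW A load-bearing): a plane-cone-free principal companion chain is
BIRTH-FREE, since a birth at step `j` would make `h_j` a rational plane cone. [folklore] -/
theorem birthFreeCompanionTower_of_planeConeFreeCompanionTower (T : ForcedTower) (g : T.St 0 ⟶ Spec (.of k))
    (hB : IsBase (T.St 0) g) {n : ℕ} (hD : IsDatum n (T.D 0)) (h3 : ThreefoldTower T) (h : PlaneConeFreeCompanionTower T) :
    BirthFreeCompanionTower T := by
  obtain ⟨m, a, b, H, K, hF, ha, hP, hpc⟩ := h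
  exact ⟨m, a, b, H, K, hF, ha, hP, fun j hj => hpc j (planeConeAt_facIter_of_bornAt T g hB hD h3 hF (by omega) hj)⟩

/-- **DECLARED DEPENDENCE (KPCF) ⟹ (KFB)** (LAW A on the cofactor chain, `FactorAt.symm`). [folklore] -/
theorem birthFreeCofactorTower_of_planeConeFreeCofactorTower (T : ForcedTower) (g : T.St 0 ⟶ Spec (.of k))
    (hB : IsBase (T.St 0) g) {n : ℕ} (hD : IsDatum n (T.D 0)) (h3 : ThreefoldTower T) (h : PlaneConeFreeCofactorTower T) :
    BirthFreeCofactorTower T := by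
  obtain ⟨m, a, b, H, K, hF, ha, hP, hb, hpc⟩ := h
  exact ⟨m, a, b, H, K, hF, ha, hP, hb, fun j hj => hpc j (planeConeAt_facIter_of_bornAt T g hB hD h3 hF.symm hb hj)⟩

/-- contrapositive, the residual letters at tower level: **BIRTH-RECURRENT ⟹ CONE-RECURRENT** (companion). [folklore] -/
theorem not_planeConeFreeCompanionTower_of_not_birthFree (T : ForcedTower) (g : T.St 0 ⟶ Spec (.of k))
    (hB : IsBase (T.St 0) g) {n : ℕ} (hD : IsDatum n (T.D 0)) (h3 : ThreefoldTower T) (h : ¬ BirthFreeCompanionTower T) :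
    ¬ PlaneConeFreeCompanionTower T := fun hpc =>
  h (birthFreeCompanionTower_of_planeConeFreeCompanionTower T g hB hD h3 hpc)

/-- contrapositive: **COFACTOR-BIRTH-RECURRENT ⟹ COFACTOR-CONE-RECURRENT**. [folklore] -/
theorem not_planeConeFreeCofactorTower_of_not_birthFree (T : ForcedTower) (g : T.St 0 ⟶ Spec (.of k))
    (hB : IsBase (T.St 0) g) {n : ℕ} (hD : IsDatum n (T.D 0)) (h3 : ThreefoldTower T) (h : ¬ BirthFreeCofactorTower T) :
    ¬ PlaneConeFreeCofactorTower T := fun hpc =>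
  h (birthFreeCofactorTower_of_planeConeFreeCofactorTower T g hB hD h3 hpc)

/-- **THE RESIDUAL LETTER ¬(PCF) UNFOLDED BY MECHANISM: every principal companion of weight `≥ 2` is a rational plane cone at
ARBITRARILY LATE stages** (re-rooting by g33 `FactorAt.forcing` / g35 `FactorAt.principal_facIter` / g38 `facIter_add_heq`). [folklore] -/
theorem frequently_planeConeAt_companion (T : ForcedTower) (g : T.St 0 ⟶ Spec (.of k)) (hB : IsBase (T.St 0) g) {n : ℕ}
    (hD : IsDatum n (T.D 0)) (hrec : ¬ PlaneConeFreeCompanionTower T) {m a b : ℕ} {H K : (T.St m).IdealSheafData}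
    (hF : FactorAt T m a b H K) (ha : 2 ≤ a) (hP : (stalkIdeal H (T.pt m)).IsPrincipal) :
    ∀ j₀, ∃ j, j₀ ≤ j ∧ PlaneConeAt (facIter T m a H j) a (T.pt (m + j)) := by
  intro j₀
  obtain ⟨j, hj⟩ := (not_planeConeFreeCompanionTower_iff T).mp hrec (m + j₀) a b (facIter T m a H j₀) (facIter T m b K j₀)
    (hF.forcing T g hB hD j₀) ha (hF.principal_facIter T g hB hD hP j₀).1
  exact ⟨j₀ + j, Nat.le_add_right j₀ j,
    (planeConeAt_pt_iff_of_heq T a (Nat.add_assoc m j₀ j) (facIter_add_heq T m a H j₀ j)).mp hj⟩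

/-- **THE RESIDUAL LETTER ¬(KPCF) UNFOLDED BY MECHANISM: the cofactor (positive weight) of every principal companion of weight `≥ 2`
is a rational plane cone at ARBITRARILY LATE stages.** [folklore] -/
theorem frequently_planeConeAt_cofactor (T : ForcedTower) (g : T.St 0 ⟶ Spec (.of k)) (hB : IsBase (T.St 0) g) {n : ℕ}
    (hD : IsDatum n (T.D 0)) (hrec : ¬ PlaneConeFreeCofactorTower T) {m a b : ℕ} {H K : (T.St m).IdealSheafData}
    (hF : FactorAt T m a b H K) (ha : 2 ≤ a) (hP : (stalkIdeal H (T.pt m)).IsPrincipal) (hb : 1 ≤ b) :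
    ∀ j₀, ∃ j, j₀ ≤ j ∧ PlaneConeAt (facIter T m b K j) b (T.pt (m + j)) := by
  intro j₀
  obtain ⟨j, hj⟩ := (not_planeConeFreeCofactorTower_iff T).mp hrec (m + j₀) a b (facIter T m a H j₀) (facIter T m b K j₀)
    (hF.forcing T g hB hD j₀) ha (hF.principal_facIter T g hB hD hP j₀).1 hb
  exact ⟨j₀ + j, Nat.le_add_right j₀ j,
    (planeConeAt_pt_iff_of_heq T b (Nat.add_assoc m j₀ j) (facIter_add_heq T m b K j₀ j)).mp hj⟩


/-- **MECHANISM OF THE NEW CORE, COMPANION CHAIN (kernel; the letters ¬(FB) of g38 and rd 3 as hypotheses)**: every principal companion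
of weight `a ≥ 2` has, at ARBITRARILY LATE steps `j`, a BIRTH which (LAW A) happens at a RATIONAL-PLANE-CONE stage of `h_j` and (LAW A′)
bears EXACTLY ONE branch — the generic point of the directrix line `ℙ(Dir(h_j)) ⊂ E_{m+j+1}` through `x_{m+j+1}`. [folklore] -/
theorem birthRecurrent_companion_mechanism (T : ForcedTower) (g : T.St 0 ⟶ Spec (.of k)) (hB : IsBase (T.St 0) g) {n : ℕ}
    (hD : IsDatum n (T.D 0)) (h3 : ThreefoldTower T) (hrec : ¬ BirthFreeCompanionTower T) {m a b : ℕ}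
    {H K : (T.St m).IdealSheafData} (hF : FactorAt T m a b H K) (ha : 2 ≤ a) (hP : (stalkIdeal H (T.pt m)).IsPrincipal) :
    ∀ j₀, ∃ j, j₀ ≤ j ∧ BornAt T m a H j ∧ PlaneConeAt (facIter T m a H j) a (T.pt (m + j)) ∧
      (bornSet T (m + j) a (facIter T m a H (j + 1))).ncard = 1 := by
  intro j₀
  obtain ⟨j, hj, hborn⟩ := frequently_bornAt_of_not_birthFree T g hB hD hrec hF ha hP j₀
  refine ⟨j, hj, hborn, planeConeAt_facIter_of_bornAt T g hB hD h3 hF (by omega) hborn, ?_⟩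
  obtain ⟨η, hη, hb⟩ := hborn
  exact Set.ncard_eq_one.mpr ⟨η, (bornSet_subsingleton T g hB h3 (by omega) (hF.forcing T g hB hD j).2.1).eq_singleton_of_mem
    ⟨hη, hb⟩⟩

/-- **MECHANISM OF THE NEW CORE, COFACTOR CHAIN (kernel; ¬(KFB) of g39 and rd 3 as hypotheses)**: the cofactor (weight `b ≥ 1`) of
every principal companion of weight `≥ 2` has, at arbitrarily late steps, a birth at a rational-plane-cone stage of `K_j` bearing exactly
one branch. [folklore] -/
theorem birthRecurrent_cofactor_mechanism (T : ForcedTower) (g : T.St 0 ⟶ Spec (.of k)) (hB : IsBase (T.St 0) g) {n : ℕ}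
    (hD : IsDatum n (T.D 0)) (h3 : ThreefoldTower T) (hrec : ¬ BirthFreeCofactorTower T) {m a b : ℕ}
    {H K : (T.St m).IdealSheafData} (hF : FactorAt T m a b H K) (ha : 2 ≤ a) (hP : (stalkIdeal H (T.pt m)).IsPrincipal)
    (hb : 1 ≤ b) :
    ∀ j₀, ∃ j, j₀ ≤ j ∧ BornAt T m b K j ∧ PlaneConeAt (facIter T m b K j) b (T.pt (m + j)) ∧
      (bornSet T (m + j) b (facIter T m b K (j + 1))).ncard = 1 := by
  intro j₀
  obtain ⟨j, hj⟩ := (not_birthFreeCofactorTower_iff T).mp hrec (m + j₀) a b (facIter T m a H j₀) (facIter T m b K j₀)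
    (hF.forcing T g hB hD j₀) ha (hF.principal_facIter T g hB hD hP j₀).1 hb
  have hborn : BornAt T m b K (j₀ + j) := (bornAt_add_iff T m b K j₀ j).mp hj
  refine ⟨j₀ + j, Nat.le_add_right j₀ j, hborn, planeConeAt_facIter_of_bornAt T g hB hD h3 hF.symm hb hborn, ?_⟩
  obtain ⟨η, hη, hb'⟩ := hborn
  exact Set.ncard_eq_one.mpr ⟨η, (bornSet_subsingleton T g hB h3 hb (hF.symm.forcing T g hB hD (j₀ + j)).2.1).eq_singleton_of_mem
    ⟨hη, hb'⟩⟩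

/-- **LAW A″ ALONG A FACTOR CHAIN: every born branch is the generic point of a REGULAR exceptional curve through `x_{m+j+1}`.** [folklore] -/
theorem isRegular_closure_of_mem_bornSet_facIter (T : ForcedTower) (g : T.St 0 ⟶ Spec (.of k)) (hB : IsBase (T.St 0) g)
    {n : ℕ} (hD : IsDatum n (T.D 0)) (h3 : ThreefoldTower T) {m a b : ℕ} {H K : (T.St m).IdealSheafData}
    (hF : FactorAt T m a b H K) (ha : 1 ≤ a) {j : ℕ} {η : T.St (m + j + 1)}
    (hη : η ∈ bornSet T (m + j) a (facIter T m a H (j + 1))) :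
    Scheme.IsRegular (vanishingIdeal (⟨closure {η}, isClosed_closure⟩ : Closeds (T.St (m + j + 1)))).subscheme :=
  isRegular_closure_of_mem_bornSet T g hB h3 ha (hF.forcing T g hB hD j).2.1 hη

/-- **THE SHARPENED COUNT LAW ALONG A FACTOR CHAIN: `μ_{j+1} ≤ μ_j + 1`** (near-branch counts of consecutive members). [folklore] -/
theorem ncard_brSet_facIter_succ_le_succ (T : ForcedTower) (g : T.St 0 ⟶ Spec (.of k)) (hB : IsBase (T.St 0) g)
    {n : ℕ} (hD : IsDatum n (T.D 0)) (h3 : ThreefoldTower T) {m a b : ℕ} {H K : (T.St m).IdealSheafData}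
    (hF : FactorAt T m a b H K) (ha : 1 ≤ a) (j : ℕ) (hfin : (brSet T (m + j) a (facIter T m a H j)).Finite) :
    (brSet T (m + j + 1) a (facIter T m a H (j + 1))).ncard ≤ (brSet T (m + j) a (facIter T m a H j)).ncard + 1 :=
  ncard_brSet_succ_le_succ T g hB h3 ha (hF.forcing T g hB hD j).2.1 hfin

/-- **THE HOP: THE TOWER HOPS OFF EVERY NEW-BORN EXCEPTIONAL LINE** (¬(CF∞) as hypothesis).  The born branch of a birth at step `j` of a
factor chain — by LAW A/A′/A″ the unique born branch, the generic point of the regular exceptional line `ℙ(Dir(h_j))` through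
`x_{m+j+1}` — is NOT threaded by the later marked points: there is no thread `ζ_{i} ⤳ x_{i}`, `ζ_i ≠ x_i`, `π_i ζ_{i+1} = ζ_i`
(`i ≥ m+j+1`) starting at it.  So a doubly narrow tower leaves the strict transforms of each born line after finitely many steps and is
re-born on a NEW one (births recur: `birthRecurrent_companion_mechanism`). [folklore] -/
theorem bornBranch_not_threaded (T : ForcedTower) (g : T.St 0 ⟶ Spec (.of k)) (hB : IsBase (T.St 0) g) {n : ℕ}
    (hD : IsDatum n (T.D 0)) (hocc : ¬ LatentFactorTower T) (h3 : ThreefoldTower T) (hCF : ¬ FollowsCurveTower T)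
    {m a b : ℕ} {H K : (T.St m).IdealSheafData} (hF : FactorAt T m a b H K) (ha : 1 ≤ a) {j : ℕ}
    (ζ : ∀ i, m + (j + 1) ≤ i → T.St i) (h0 : ζ (m + (j + 1)) le_rfl ∈ bornSet T (m + j) a (facIter T m a H (j + 1)))
    (hsp : ∀ i (h : m + (j + 1) ≤ i), ζ i h ⤳ T.pt i) (hne : ∀ i (h : m + (j + 1) ≤ i), ζ i h ≠ T.pt i)
    (hπζ : ∀ i (h : m + (j + 1) ≤ i), (T.π i).base (ζ (i + 1) (Nat.le_succ_of_le h)) = ζ i h) : False :=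
  not_threaded_of_not_followsCurveTower T g hB hocc h3 hCF (hF.forcing T g hB hD (j + 1)) ha ζ h0.1 hsp hne hπζ

end DirectrixKernels

end Summit.ResolutionOfSingularities.ResolutionOfSingularities.Theorems.HugValuationCut
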